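import Literature.MathematicalPhysics.QuantumFieldTheory.ConformalBootstrap3D.BlockExchangeSymmetry
import Literature.MathematicalPhysics.QuantumFieldTheory.ConformalBootstrap3D.BlockCoefficientExtraction
import Mathlib.Analysis.Calculus.Deriv.CompMul
import HarnessLib

/-!
# Coefficient extraction for a 3D Casimir solution known on a sub-square `(0,δ)²`

`BlockCoefficientExtraction.satisfiesCoeffCasimir_of_casimirEq3D` extracts the five-term monomial system
`SatisfiesCoeffCasimir` (Dolan–Osborn 2011, §2 eqs. (2.9)–(2.12)) from the quadratic Casimir equation of a
function `g = (z z̄)^α K` whose double `z`-series `K` converges on the UNIT bidisk and which solves the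
equation on the whole square `(0,1)²`. The `1 ↔ 2` exchange `x ↦ x/(x-1)` of Dolan–Osborn 2011 eq. (2.23)
produces a solution whose `z`-series is only known to converge for `|z|, |z̄| < 1/2` and which solves the
equation on `(0,1/2)²` (`BlockExchangeTransform`, `BlockExchangeSeries`). This file supplies the extraction
step for that situation, for any radius `δ > 0`:

* the rescaled function `G(τ,τ̄) = g(δτ, δτ̄)` of a Casimir solution on `(0,δ)²` solves on `(0,1)²` the
  `δ`-SCALED Casimir equation `casimirExprScaled δ … G = 0`, in which every degree-raising term of the
  Dolan–Osborn operator carries a factor `δ` (`casimirExpr3D_scale`, chain rule);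
* for `G = u (ττ̄)^α K̂` with `K̂ = Σ k̂_{mn} τ^m τ̄^n` absolutely convergent on the unit bidisk, the scaled
  equation on `(0,1)²` forces the scaled monomial system `coeffCasimirLHSScaled δ … k̂ P Q = 0`
  (`= coeffLAB + δ·coeffLCDE`; termwise differentiation of generalised power series and the identity
  theorem, verbatim as in `BlockCoefficientExtraction`) — `coeffCasimirLHSScaled_eq_zero_of_casimirExprScaled`;
* with `k̂_{mn} = δ^{m+n} k_{mn}` the scaled system for `k̂` is `δ^{P+Q-1}` times the original system for `k`
  (`mul_coeffCasimirLHSScaled_smul`), whence `SatisfiesCoeffCasimir (-Δ₁₂/2) (Δ₃₄/2) Δ ℓ k`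
  (`satisfiesCoeffCasimir_of_casimirEq3D_subsquare`).

At `δ = 1`, `u = 1` this is the extraction theorem of `BlockCoefficientExtraction` (`casimirExprScaled_one`,
`coeffCasimirLHSScaled_one`). Nothing here is specific to the exchange symmetry; it is the same
Dolan–Osborn computation "substituting the expansion into the Casimir equation gives the recurrence"
(Dolan–Osborn 2011, §2, between (2.9) and (2.12)) carried out in the rescaled variable.

Sources: F. A. Dolan, H. Osborn, *Conformal partial waves: further mathematical results*, arXiv:1108.6194,
§2 eqs. (2.9)–(2.12). Mathlib: `deriv_comp_mul_left`, `deriv_const_mul_field`. Tree: `gps`, `GeomSummable`,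
`IsDoublePowerSeriesOn`, `coeffA … coeffE`, `coeffLAB`, `coeffLCDE`, `coeffCasimirLHS`, `hasSum_shift10 … 02`,
`eq_zero_of_double_tsum_eq_zero`, `casimirExpr3D`.
-/

namespace Literature.MathematicalPhysics.QuantumFieldTheory.ConformalBootstrap3D

open Set Filter Topology

/-! ### 1. Chain rule for the rescaling `t ↦ δ t` -/

/-- `d/dt f(δt) = δ f'(δt)` (no differentiability hypothesis: both sides vanish together). [folklore] -/
private theorem deriv_comp_scale (f : ℝ → ℝ) (δ τ : ℝ) :
    deriv (fun t => f (δ * t)) τ = δ * deriv f (δ * τ) := by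
  have h := deriv_comp_mul_left δ f τ
  simpa only [smul_eq_mul] using h

/-- `d²/dt² f(δt) = δ² f''(δt)`. [folklore] -/
private theorem deriv_deriv_comp_scale (f : ℝ → ℝ) (δ τ : ℝ) :
    deriv (deriv (fun t => f (δ * t))) τ = δ ^ 2 * deriv (deriv f) (δ * τ) := by
  have h1 : deriv (fun t => f (δ * t)) = fun t => δ * deriv f (δ * t) := by
    funext t; exact deriv_comp_scale f δ t
  have h2 : deriv (fun t => δ * deriv f (δ * t)) τ = δ * deriv (fun t => deriv f (δ * t)) τ :=
    deriv_const_mul_field δ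
  rw [h1, h2, deriv_comp_scale (deriv f) δ τ]
  ring

/-! ### 2. The `δ`-scaled Casimir operator -/

/-- The `δ`-scaled Dolan–Osborn operator
`D^δ_x(a,b) f = x²(1-δx) f'' - (a+b+1) δ x² f' - a b δ x f`: the operator `D_z(a,b)` of
`dolanOsbornD` written in the variable `x = z/δ` (`dolanOsbornDScaled_one`: `δ = 1` is `dolanOsbornD`).
[cite: DolanOsborn2011, §2 eq. (2.9)] -/
noncomputable def dolanOsbornDScaled (δ a b : ℝ) (f : ℝ → ℝ) (x : ℝ) : ℝ :=
  x ^ 2 * (1 - δ * x) * deriv (deriv f) x - (a + b + 1) * δ * x ^ 2 * deriv f x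
    - a * b * δ * x * f x

/-- The `δ`-scaled quadratic Casimir expression
`(τ-τ̄)[D^δ_τ G + D^δ_τ̄ G - c G] + ττ̄[(1-δτ)∂_τ G - (1-δτ̄)∂_τ̄ G]`: the Casimir expression
`casimirExpr3D` of `g` at `(δτ, δτ̄)` is `δ` times this expression of `G(τ,τ̄) = g(δτ,δτ̄)`
(`casimirExpr3D_scale`). [cite: DolanOsborn2011, §2 eq. (2.9)] -/
noncomputable def casimirExprScaled (δ Δ₁₂ Δ₃₄ Δ : ℝ) (ℓ : ℕ) (G : ℝ → ℝ → ℝ) (τ τb : ℝ) : ℝ :=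
  (τ - τb) * (dolanOsbornDScaled δ (-Δ₁₂ / 2) (Δ₃₄ / 2) (fun t => G t τb) τ
        + dolanOsbornDScaled δ (-Δ₁₂ / 2) (Δ₃₄ / 2) (fun t => G τ t) τb
        - casimirEigenvalue3D Δ ℓ * G τ τb)
      + τ * τb * ((1 - δ * τ) * deriv (fun t => G t τb) τ
        - (1 - δ * τb) * deriv (fun t => G τ t) τb)

/-- At `δ = 1` the scaled operator is `dolanOsbornD`. [folklore] -/
private theorem dolanOsbornDScaled_one (a b : ℝ) (f : ℝ → ℝ) (x : ℝ) :
    dolanOsbornDScaled 1 a b f x = dolanOsbornD a b f x := by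
  unfold dolanOsbornDScaled dolanOsbornD; ring

/-- At `δ = 1` the scaled expression is `casimirExpr3D`. [folklore] -/
private theorem casimirExprScaled_one (Δ₁₂ Δ₃₄ Δ : ℝ) (ℓ : ℕ) (G : ℝ → ℝ → ℝ) (τ τb : ℝ) :
    casimirExprScaled 1 Δ₁₂ Δ₃₄ Δ ℓ G τ τb = casimirExpr3D Δ₁₂ Δ₃₄ Δ ℓ G τ τb := by
  unfold casimirExprScaled casimirExpr3D
  rw [dolanOsbornDScaled_one, dolanOsbornDScaled_one]
  ring

/-- `dolanOsbornDScaled` only sees the germ of `f` at `x`. [folklore] -/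
private theorem dolanOsbornDScaled_congr_of_eventuallyEq {f₁ f₂ : ℝ → ℝ} {x : ℝ} (h : f₁ =ᶠ[𝓝 x] f₂)
    (δ a b : ℝ) : dolanOsbornDScaled δ a b f₁ x = dolanOsbornDScaled δ a b f₂ x := by
  have hd : deriv f₁ =ᶠ[𝓝 x] deriv f₂ := h.deriv
  unfold dolanOsbornDScaled
  rw [h.deriv_eq, hd.deriv_eq, h.eq_of_nhds]

/-- `dolanOsbornDScaled` of a generalised power series on `(0,1)`, termwise. [folklore] -/
private theorem GeomSummable.dolanOsbornDScaled_gps {ι : Type*} {c : ι → ℝ} {w : ι → ℕ}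
    (h : GeomSummable c w) (δ a b β : ℝ) {z : ℝ} (hz : z ∈ Ioo (0 : ℝ) 1) :
    dolanOsbornDScaled δ a b (gps c w β) z =
      z ^ 2 * (1 - δ * z) *
          gps (fun i => c i * ((w i : ℝ) + β) * ((w i : ℝ) + (β - 1))) w (β - 1 - 1) z
        - (a + b + 1) * δ * z ^ 2 * gps (fun i => c i * ((w i : ℝ) + β)) w (β - 1) z
        - a * b * δ * z * gps c w β z := by
  unfold dolanOsbornDScaled
  rw [h.deriv_deriv_gps β hz, h.deriv_gps β hz]

/-- **Scaling covariance of the Casimir expression**: for every `δ` and every `g`,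
`casimirExpr3D g (δτ, δτ̄) = δ · casimirExprScaled δ (g ∘ (δ·)) (τ, τ̄)` (chain rule
`∂_τ g(δτ) = δ (∂g)(δτ)`; in `D_z = z²(1-z)∂² - (a+b+1)z²∂ - abz` the powers of `δ` from `z = δτ`
and from the derivatives cancel except for one factor `δ` on each degree-raising term).
[cite: DolanOsborn2011, §2 eq. (2.9)] -/
theorem casimirExpr3D_scale (δ Δ₁₂ Δ₃₄ Δ : ℝ) (ℓ : ℕ) (g : ℝ → ℝ → ℝ) (τ τb : ℝ) :
    casimirExpr3D Δ₁₂ Δ₃₄ Δ ℓ g (δ * τ) (δ * τb) =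
      δ * casimirExprScaled δ Δ₁₂ Δ₃₄ Δ ℓ (fun s t => g (δ * s) (δ * t)) τ τb := by
  have d1 : deriv (fun t => g (δ * t) (δ * τb)) τ = δ * deriv (fun x => g x (δ * τb)) (δ * τ) :=
    deriv_comp_scale (fun x => g x (δ * τb)) δ τ
  have d1' : deriv (deriv (fun t => g (δ * t) (δ * τb))) τ =
      δ ^ 2 * deriv (deriv (fun x => g x (δ * τb))) (δ * τ) :=
    deriv_deriv_comp_scale (fun x => g x (δ * τb)) δ τ
  have d2 : deriv (fun t => g (δ * τ) (δ * t)) τb = δ * deriv (fun x => g (δ * τ) x) (δ * τb) :=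
    deriv_comp_scale (fun x => g (δ * τ) x) δ τb
  have d2' : deriv (deriv (fun t => g (δ * τ) (δ * t))) τb =
      δ ^ 2 * deriv (deriv (fun x => g (δ * τ) x)) (δ * τb) :=
    deriv_deriv_comp_scale (fun x => g (δ * τ) x) δ τb
  unfold casimirExprScaled casimirExpr3D dolanOsbornDScaled dolanOsbornD
  rw [d1, d1', d2, d2']
  ring

/-! ### 3. The `δ`-scaled coefficient system -/

/-- The left-hand side of the coefficient equation of the monomial `τ^{P+α} τ̄^{Q+α}` in the `δ`-scaled
Casimir equation of `u (ττ̄)^α Σ k_{mn} τ^m τ̄^n`: the degree-raising-by-one half `coeffLAB` of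
`coeffCasimirLHS` plus `δ` times its degree-raising-by-two half `coeffLCDE`.
[cite: DolanOsborn2011, §2 eqs. (2.10)–(2.12)] -/
noncomputable def coeffCasimirLHSScaled (δ a b Δ : ℝ) (ℓ : ℕ) (k : ℕ × ℕ → ℝ) (P Q : ℕ) : ℝ :=
  coeffLAB Δ ℓ k P Q + δ * coeffLCDE a b Δ ℓ k P Q

/-- At `δ = 1` the scaled system is `coeffCasimirLHS`. [folklore] -/
private theorem coeffCasimirLHSScaled_one (a b Δ : ℝ) (ℓ : ℕ) (k : ℕ × ℕ → ℝ) (P Q : ℕ) :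
    coeffCasimirLHSScaled 1 a b Δ ℓ k P Q = coeffCasimirLHS a b Δ ℓ k P Q := by
  rw [coeffCasimirLHSScaled, one_mul, coeffCasimirLHS_eq_add]

/-- **The scaled system of the rescaled array is the original system**: for `k̂_{mn} = δ^{m+n} k_{mn}`,
`δ · E^δ_{PQ}(k̂) = δ^{P+Q} E_{PQ}(k)` (every term of `E_{PQ}` involves an entry of total degree `P+Q-1`
with weight `δ⁰`, or of total degree `P+Q-2` with weight `δ¹`). [folklore] -/
private theorem mul_coeffCasimirLHSScaled_smul (δ a b Δ : ℝ) (ℓ : ℕ) (k : ℕ × ℕ → ℝ) (P Q : ℕ) :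
    δ * coeffCasimirLHSScaled δ a b Δ ℓ (fun q : ℕ × ℕ => δ ^ (q.1 + q.2) * k q) P Q =
      δ ^ (P + Q) * coeffCasimirLHS a b Δ ℓ k P Q := by
  have h2 : ∀ n : ℕ, n + 1 + 1 - 2 = n := fun n => by omega
  unfold coeffCasimirLHSScaled coeffLAB coeffLCDE coeffCasimirLHS
  rcases P with _ | _ | P <;> rcases Q with _ | _ | Q <;>
    simp (disch := omega) only [if_pos, if_neg, Nat.add_sub_cancel, h2, zero_add] <;> ring

/-! ### 4. Termwise evaluation of the scaled Casimir expression -/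

section Main

variable {khat : ℕ × ℕ → ℝ} {Kh G : ℝ → ℝ → ℝ} {δ u Δ₁₂ Δ₃₄ Δ : ℝ} {ℓ : ℕ}

/-- **The scaled Casimir equation holds coefficientwise** (the computation of
`BlockCoefficientExtraction.satisfiesCoeffCasimir_of_casimirEq3D`, Step 1, for the `δ`-scaled operator):
for `G = u (ττ̄)^{(Δ-ℓ)/2} K̂` on `(0,1)²`, `u ≠ 0`, `K̂ = Σ k̂_{mn} τ^m τ̄^n` absolutely convergent on the unit
bidisk, and `casimirExprScaled δ … G = 0` on `(0,1)²`, the double series `Σ_{P,Q} E^δ_{PQ}(k̂) τ^P τ̄^Q`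
converges to `0` at every point of `(0,1)²`. [cite: DolanOsborn2011, §2 eqs. (2.9)–(2.12)] -/
theorem summable_and_tsum_coeffCasimirLHSScaled (hS : IsDoublePowerSeriesOn khat Kh) (hu : u ≠ 0)
    (hG : ∀ z zb : ℝ, z ∈ Ioo (0 : ℝ) 1 → zb ∈ Ioo (0 : ℝ) 1 →
      G z zb = u * (z * zb) ^ ((Δ - (ℓ : ℝ)) / 2) * Kh z zb)
    (hPDE : ∀ z zb : ℝ, z ∈ Ioo (0 : ℝ) 1 → zb ∈ Ioo (0 : ℝ) 1 →
      casimirExprScaled δ Δ₁₂ Δ₃₄ Δ ℓ G z zb = 0) :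
    ∀ z zb : ℝ, 0 < z → z < 1 → 0 < zb → zb < 1 →
      Summable (fun q : ℕ × ℕ =>
          coeffCasimirLHSScaled δ (-Δ₁₂ / 2) (Δ₃₄ / 2) Δ ℓ khat q.1 q.2 * z ^ q.1 * zb ^ q.2) ∧
        ∑' q : ℕ × ℕ,
            coeffCasimirLHSScaled δ (-Δ₁₂ / 2) (Δ₃₄ / 2) Δ ℓ khat q.1 q.2 * z ^ q.1 * zb ^ q.2
          = 0 := by
  intro z zb hz0 hz1 hzb0 hzb1
  have hz : z ∈ Ioo (0 : ℝ) 1 := ⟨hz0, hz1⟩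
  have hzb : zb ∈ Ioo (0 : ℝ) 1 := ⟨hzb0, hzb1⟩
  have hG' : ∀ z zb : ℝ, z ∈ Ioo (0 : ℝ) 1 → zb ∈ Ioo (0 : ℝ) 1 →
      G z zb = u * (z * zb) ^ (halfTwist Δ ℓ) * Kh z zb := fun z zb hz hzb => by
    rw [hG z zb hz hzb]; rfl
  -- the two partial functions of `G` are generalised power series on `(0,1)`
  have G1 : GeomSummable
      (fun p : ℕ × ℕ => khat p * ((u * zb ^ (halfTwist Δ ℓ)) * zb ^ p.2)) Prod.fst :=
    hS.geomSummable_fst hzb0.le hzb1 _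
  have G2 : GeomSummable
      (fun p : ℕ × ℕ => khat p * ((u * z ^ (halfTwist Δ ℓ)) * z ^ p.1)) Prod.snd :=
    hS.geomSummable_snd hz0.le hz1 _
  have E1 : EqOn (fun t => G t zb)
      (gps (fun p : ℕ × ℕ => khat p * ((u * zb ^ (halfTwist Δ ℓ)) * zb ^ p.2)) Prod.fst
        (halfTwist Δ ℓ)) (Ioo 0 1) := by
    intro t ht
    simp only [gps]
    rw [hG' t zb ht hzb, hS.eq_tsum ht.1.le ht.2 hzb0.le hzb1, Real.mul_rpow ht.1.le hzb0.le,
      ← tsum_mul_left]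
    refine tsum_congr fun p => ?_
    rw [Real.rpow_add ht.1, Real.rpow_natCast]; ring
  have E2 : EqOn (fun t => G z t)
      (gps (fun p : ℕ × ℕ => khat p * ((u * z ^ (halfTwist Δ ℓ)) * z ^ p.1)) Prod.snd
        (halfTwist Δ ℓ)) (Ioo 0 1) := by
    intro t ht
    simp only [gps]
    rw [hG' z t hz ht, hS.eq_tsum hz0.le hz1 ht.1.le ht.2, Real.mul_rpow hz0.le ht.1.le,
      ← tsum_mul_left]
    refine tsum_congr fun p => ?_
    rw [Real.rpow_add ht.1, Real.rpow_natCast]; ring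
  have e1 := Filter.eventuallyEq_of_mem (Ioo_mem_nhds hz0 hz1) E1
  have e2 := Filter.eventuallyEq_of_mem (Ioo_mem_nhds hzb0 hzb1) E2
  have gz : G z zb = gps (fun p : ℕ × ℕ => khat p * ((u * zb ^ (halfTwist Δ ℓ)) * zb ^ p.2))
      Prod.fst (halfTwist Δ ℓ) z := E1 hz
  -- the scaled Casimir equation in terms of the six generalised power series
  have hCz := hPDE z zb hz hzb
  unfold casimirExprScaled at hCz
  rw [dolanOsbornDScaled_congr_of_eventuallyEq e1, dolanOsbornDScaled_congr_of_eventuallyEq e2,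
    e1.deriv_eq, e2.deriv_eq, G1.dolanOsbornDScaled_gps _ _ _ _ hz,
    G2.dolanOsbornDScaled_gps _ _ _ _ hzb, G1.deriv_gps _ hz, G2.deriv_gps _ hzb, gz] at hCz
  -- the six `HasSum`s
  have hT1 := G1.hasSum_gps hz0 hz1 (halfTwist Δ ℓ)
  have hT1' := (G1.mul_weight (halfTwist Δ ℓ)).hasSum_gps hz0 hz1 (halfTwist Δ ℓ - 1)
  have hT1'' := ((G1.mul_weight (halfTwist Δ ℓ)).mul_weight (halfTwist Δ ℓ - 1)).hasSum_gps hz0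
    hz1 (halfTwist Δ ℓ - 1 - 1)
  have hT2 := G2.hasSum_gps hzb0 hzb1 (halfTwist Δ ℓ)
  have hT2' := (G2.mul_weight (halfTwist Δ ℓ)).hasSum_gps hzb0 hzb1 (halfTwist Δ ℓ - 1)
  have hT2'' := ((G2.mul_weight (halfTwist Δ ℓ)).mul_weight (halfTwist Δ ℓ - 1)).hasSum_gps hzb0
    hzb1 (halfTwist Δ ℓ - 1 - 1)
  have hL := ((((((hT1''.mul_left (z ^ 2 * (1 - δ * z))).sub
      (hT1'.mul_left (((-Δ₁₂ / 2) + Δ₃₄ / 2 + 1) * δ * z ^ 2))).sub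
      (hT1.mul_left ((-Δ₁₂ / 2) * (Δ₃₄ / 2) * δ * z))).add
      (((hT2''.mul_left (zb ^ 2 * (1 - δ * zb))).sub
        (hT2'.mul_left (((-Δ₁₂ / 2) + Δ₃₄ / 2 + 1) * δ * zb ^ 2))).sub
        (hT2.mul_left ((-Δ₁₂ / 2) * (Δ₃₄ / 2) * δ * zb)))).sub
      (hT1.mul_left (casimirEigenvalue3D Δ ℓ))).mul_left (z - zb)).add
    (((hT1'.mul_left (1 - δ * z)).sub (hT2'.mul_left (1 - δ * zb))).mul_left (z * zb))
  -- … whose sum is the scaled Casimir expression, i.e. `0`; termwise it is `u (z z̄)^α k̂_p Ψ^δ_p`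
  have R1 : ∀ (m : ℕ) (β : ℝ), z ^ ((m : ℝ) + β) = z ^ β * z ^ m := fun m β => by
    rw [Real.rpow_add hz0, Real.rpow_natCast, mul_comm]
  have R2 : ∀ (m : ℕ) (β : ℝ), zb ^ ((m : ℝ) + β) = zb ^ β * zb ^ m := fun m β => by
    rw [Real.rpow_add hzb0, Real.rpow_natCast, mul_comm]
  have hzne : z ≠ 0 := hz0.ne'
  have hzbne : zb ≠ 0 := hzb0.ne'
  have h1 := hL.tsum_eq.trans (show _ = (0 : ℝ) by linear_combination hCz)
  have hc : u * (z * zb) ^ (halfTwist Δ ℓ) ≠ 0 :=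
    mul_ne_zero hu (Real.rpow_pos_of_pos (mul_pos hz0 hzb0) _).ne'
  have hval : ∑' p : ℕ × ℕ, u * (z * zb) ^ (halfTwist Δ ℓ) *
      (coeffA Δ ℓ p.1 p.2 * khat p * z ^ (p.1 + 1) * zb ^ p.2
        + coeffB Δ ℓ p.1 p.2 * khat p * z ^ p.1 * zb ^ (p.2 + 1)
        + δ * (coeffC (-Δ₁₂ / 2) (Δ₃₄ / 2) Δ ℓ p.1 * khat p * z ^ (p.1 + 2) * zb ^ p.2)
        + δ * (coeffD (-Δ₁₂ / 2) (Δ₃₄ / 2) Δ ℓ p.1 p.2 * khat p * z ^ (p.1 + 1) * zb ^ (p.2 + 1))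
        + δ * (coeffE (-Δ₁₂ / 2) (Δ₃₄ / 2) Δ ℓ p.2 * khat p * z ^ p.1 * zb ^ (p.2 + 2))) = 0 := by
    refine (tsum_congr fun p => ?_).trans h1
    simp only [R1, R2, Real.rpow_sub_one hzne, Real.rpow_sub_one hzbne,
      Real.mul_rpow hz0.le hzb0.le, coeffA, coeffB, coeffC, coeffD, coeffE]
    field_simp
    ring
  have hval' : ∑' p : ℕ × ℕ,
      (coeffA Δ ℓ p.1 p.2 * khat p * z ^ (p.1 + 1) * zb ^ p.2
        + coeffB Δ ℓ p.1 p.2 * khat p * z ^ p.1 * zb ^ (p.2 + 1)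
        + δ * (coeffC (-Δ₁₂ / 2) (Δ₃₄ / 2) Δ ℓ p.1 * khat p * z ^ (p.1 + 2) * zb ^ p.2)
        + δ * (coeffD (-Δ₁₂ / 2) (Δ₃₄ / 2) Δ ℓ p.1 p.2 * khat p * z ^ (p.1 + 1) * zb ^ (p.2 + 1))
        + δ * (coeffE (-Δ₁₂ / 2) (Δ₃₄ / 2) Δ ℓ p.2 * khat p * z ^ p.1 * zb ^ (p.2 + 2))) = 0 := by
    rw [tsum_mul_left] at hval
    exact (mul_eq_zero.mp hval).resolve_left hc
  -- the five pieces and their pushforwards to the monomial `τ^P τ̄^Q`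
  have sA := hS.summable_pieceA hz0.le hz1 hzb0.le hzb1 Δ ℓ
  have sB := hS.summable_pieceB hz0.le hz1 hzb0.le hzb1 Δ ℓ
  have sC := (hS.summable_pieceC hz0.le hz1 hzb0.le hzb1 (-Δ₁₂ / 2) (Δ₃₄ / 2) Δ ℓ).mul_left δ
  have sD := (hS.summable_pieceD hz0.le hz1 hzb0.le hzb1 (-Δ₁₂ / 2) (Δ₃₄ / 2) Δ ℓ).mul_left δ
  have sE := (hS.summable_pieceE hz0.le hz1 hzb0.le hzb1 (-Δ₁₂ / 2) (Δ₃₄ / 2) Δ ℓ).mul_left δ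
  have hsum0 : (∑' p : ℕ × ℕ, coeffA Δ ℓ p.1 p.2 * khat p * z ^ (p.1 + 1) * zb ^ p.2)
      + (∑' p : ℕ × ℕ, coeffB Δ ℓ p.1 p.2 * khat p * z ^ p.1 * zb ^ (p.2 + 1))
      + (∑' p : ℕ × ℕ,
          δ * (coeffC (-Δ₁₂ / 2) (Δ₃₄ / 2) Δ ℓ p.1 * khat p * z ^ (p.1 + 2) * zb ^ p.2))
      + (∑' p : ℕ × ℕ,
          δ * (coeffD (-Δ₁₂ / 2) (Δ₃₄ / 2) Δ ℓ p.1 p.2 * khat p * z ^ (p.1 + 1)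
            * zb ^ (p.2 + 1)))
      + (∑' p : ℕ × ℕ,
          δ * (coeffE (-Δ₁₂ / 2) (Δ₃₄ / 2) Δ ℓ p.2 * khat p * z ^ p.1 * zb ^ (p.2 + 2)))
      = 0 :=
    ((((sA.hasSum.add sB.hasSum).add sC.hasSum).add sD.hasSum).add sE.hasSum).tsum_eq.symm.trans
      hval'
  have hA := hasSum_shift10
    (G := fun q : ℕ × ℕ => coeffA Δ ℓ (q.1 - 1) q.2 * khat (q.1 - 1, q.2) * z ^ q.1 * zb ^ q.2)
    (by simpa using sA.hasSum)
  have hB := hasSum_shift01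
    (G := fun q : ℕ × ℕ => coeffB Δ ℓ q.1 (q.2 - 1) * khat (q.1, q.2 - 1) * z ^ q.1 * zb ^ q.2)
    (by simpa using sB.hasSum)
  have hC' := hasSum_shift20
    (G := fun q : ℕ × ℕ =>
      δ * (coeffC (-Δ₁₂ / 2) (Δ₃₄ / 2) Δ ℓ (q.1 - 2) * khat (q.1 - 2, q.2) * z ^ q.1 * zb ^ q.2))
    (by simpa using sC.hasSum)
  have hD := hasSum_shift11
    (G := fun q : ℕ × ℕ =>
      δ * (coeffD (-Δ₁₂ / 2) (Δ₃₄ / 2) Δ ℓ (q.1 - 1) (q.2 - 1) * khat (q.1 - 1, q.2 - 1) * z ^ q.1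
        * zb ^ q.2))
    (by simpa using sD.hasSum)
  have hE5 := hasSum_shift02
    (G := fun q : ℕ × ℕ =>
      δ * (coeffE (-Δ₁₂ / 2) (Δ₃₄ / 2) Δ ℓ (q.2 - 2) * khat (q.1, q.2 - 2) * z ^ q.1 * zb ^ q.2))
    (by simpa using sE.hasSum)
  have hq := (((hA.add hB).add hC').add hD).add hE5
  rw [hsum0] at hq
  -- the summand of `hq` at `q = (P,Q)` is `E^δ_{PQ}(k̂) τ^P τ̄^Q`
  obtain ⟨f, hf, hfq⟩ : ∃ f : ℕ × ℕ → ℝ, HasSum f 0 ∧ ∀ q, f q =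
      coeffCasimirLHSScaled δ (-Δ₁₂ / 2) (Δ₃₄ / 2) Δ ℓ khat q.1 q.2 * z ^ q.1 * zb ^ q.2 :=
    ⟨_, hq, fun q => by
      simp only [coeffCasimirLHSScaled, coeffLAB, coeffLCDE]
      split_ifs <;> ring⟩
  have hfeq : f = fun q : ℕ × ℕ =>
      coeffCasimirLHSScaled δ (-Δ₁₂ / 2) (Δ₃₄ / 2) Δ ℓ khat q.1 q.2 * z ^ q.1 * zb ^ q.2 :=
    funext hfq
  rw [hfeq] at hf
  exact ⟨hf.summable, hf.tsum_eq⟩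

/-- **The scaled coefficient system.** Under the hypotheses of
`summable_and_tsum_coeffCasimirLHSScaled`, `E^δ_{PQ}(k̂) = 0` for all `(P,Q)` (identity theorem for real
double power series on `(0,1)²`). [cite: DolanOsborn2011, §2 eqs. (2.9)–(2.12)] -/
theorem coeffCasimirLHSScaled_eq_zero_of_casimirExprScaled (hS : IsDoublePowerSeriesOn khat Kh)
    (hu : u ≠ 0)
    (hG : ∀ z zb : ℝ, z ∈ Ioo (0 : ℝ) 1 → zb ∈ Ioo (0 : ℝ) 1 →
      G z zb = u * (z * zb) ^ ((Δ - (ℓ : ℝ)) / 2) * Kh z zb)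
    (hPDE : ∀ z zb : ℝ, z ∈ Ioo (0 : ℝ) 1 → zb ∈ Ioo (0 : ℝ) 1 →
      casimirExprScaled δ Δ₁₂ Δ₃₄ Δ ℓ G z zb = 0) :
    ∀ P Q : ℕ, coeffCasimirLHSScaled δ (-Δ₁₂ / 2) (Δ₃₄ / 2) Δ ℓ khat P Q = 0 := by
  have hzero := eq_zero_of_double_tsum_eq_zero
    (fun q : ℕ × ℕ => coeffCasimirLHSScaled δ (-Δ₁₂ / 2) (Δ₃₄ / 2) Δ ℓ khat q.1 q.2)
    (summable_and_tsum_coeffCasimirLHSScaled hS hu hG hPDE)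
  intro P Q
  simpa using congrFun hzero (P, Q)

end Main

/-! ### 5. Extraction on a sub-square -/

/-- **Coefficient extraction from the Casimir equation on a sub-square `(0,δ)²`.** Let `δ > 0` and let
`g` solve the quadratic Casimir equation `CasimirEq3D Δ₁₂ Δ₃₄ Δ ℓ` at every point `(δτ, δτ̄)`,
`τ, τ̄ ∈ (0,1)`, where `g(δτ, δτ̄) = (δτ·δτ̄)^{(Δ-ℓ)/2} K_δ(τ,τ̄)` with `K_δ = Σ δ^{m+n} k_{mn} τ^m τ̄^n`
absolutely convergent on the unit bidisk (that is: `g = (z z̄)^{(Δ-ℓ)/2} Σ k_{mn} z^m z̄^n` with the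
series convergent for `|z|, |z̄| < δ`). Then `k` solves the monomial Casimir system
`SatisfiesCoeffCasimir (-Δ₁₂/2) (Δ₃₄/2) Δ ℓ k`. (`δ = 1`: `satisfiesCoeffCasimir_of_casimirEq3D`.)
[cite: DolanOsborn2011, §2 eqs. (2.9)–(2.12)] -/
theorem satisfiesCoeffCasimir_of_casimirEq3D_subsquare {k : ℕ × ℕ → ℝ} {Kδ g : ℝ → ℝ → ℝ}
    {δ Δ₁₂ Δ₃₄ Δ : ℝ} {ℓ : ℕ} (hδ : 0 < δ)
    (hS : IsDoublePowerSeriesOn (fun q : ℕ × ℕ => δ ^ (q.1 + q.2) * k q) Kδ)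
    (hg : ∀ τ τb : ℝ, τ ∈ Ioo (0 : ℝ) 1 → τb ∈ Ioo (0 : ℝ) 1 →
      g (δ * τ) (δ * τb) = ((δ * τ) * (δ * τb)) ^ ((Δ - (ℓ : ℝ)) / 2) * Kδ τ τb)
    (hC : ∀ τ τb : ℝ, τ ∈ Ioo (0 : ℝ) 1 → τb ∈ Ioo (0 : ℝ) 1 →
      CasimirEq3D Δ₁₂ Δ₃₄ Δ ℓ g (δ * τ) (δ * τb)) :
    SatisfiesCoeffCasimir (-Δ₁₂ / 2) (Δ₃₄ / 2) Δ ℓ k := by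
  have hu : (δ * δ) ^ ((Δ - (ℓ : ℝ)) / 2) ≠ 0 := (Real.rpow_pos_of_pos (mul_pos hδ hδ) _).ne'
  have hG : ∀ τ τb : ℝ, τ ∈ Ioo (0 : ℝ) 1 → τb ∈ Ioo (0 : ℝ) 1 →
      (fun s t => g (δ * s) (δ * t)) τ τb =
        (δ * δ) ^ ((Δ - (ℓ : ℝ)) / 2) * (τ * τb) ^ ((Δ - (ℓ : ℝ)) / 2) * Kδ τ τb := by
    intro τ τb hτ hτb
    show g (δ * τ) (δ * τb) = _
    rw [hg τ τb hτ hτb, show δ * τ * (δ * τb) = (δ * δ) * (τ * τb) by ring,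
      Real.mul_rpow (mul_pos hδ hδ).le (mul_pos hτ.1 hτb.1).le]
  have hE : ∀ τ τb : ℝ, τ ∈ Ioo (0 : ℝ) 1 → τb ∈ Ioo (0 : ℝ) 1 →
      casimirExprScaled δ Δ₁₂ Δ₃₄ Δ ℓ (fun s t => g (δ * s) (δ * t)) τ τb = 0 := by
    intro τ τb hτ hτb
    have h := (casimirEq3D_iff Δ₁₂ Δ₃₄ Δ ℓ g (δ * τ) (δ * τb)).mp (hC τ τb hτ hτb)
    rw [casimirExpr3D_scale] at h
    exact (mul_eq_zero.mp h).resolve_left hδ.ne'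
  have hscaled := coeffCasimirLHSScaled_eq_zero_of_casimirExprScaled
    (G := fun s t => g (δ * s) (δ * t)) hS hu hG hE
  intro P Q
  have h1 : δ ^ (P + Q) * coeffCasimirLHS (-Δ₁₂ / 2) (Δ₃₄ / 2) Δ ℓ k P Q = 0 := by
    rw [← mul_coeffCasimirLHSScaled_smul, hscaled P Q, mul_zero]
  exact (mul_eq_zero.mp h1).resolve_left (pow_ne_zero _ hδ.ne')

end Literature.MathematicalPhysics.QuantumFieldTheory.ConformalBootstrap3D
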